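import Summits.HodgeConjecture.HodgeConjecture.Theorems.F0P3cStCharTSHyperbolicSetEigen      -- ★ HYP-EIG (F0P2-p02 (g15)): `mem_hyperbolicSet_iff`, `exists_isRoot_of_mem_hyperbolicSet`, `mem_hyperbolicSet_of_isRoot`; brings ★ `TorusDefs.hyperbolicSet`
import Literature.NumberTheory.Rogawski1990.FinExplicitTransferFactorStableInvariance          -- ★ p839998: `finCharpolyTwo_eq_of_isLocalStablyConjH`, `finGammaTwo_eq_of_isLocalStablyConjH`, `isStablyConj_endoEmbLocal_of_isLocalStablyConjH`
import Literature.NumberTheory.Rogawski1990.LocalNormFibreNonsplit                            -- ★ `charpoly_endoEmbLocal` (`charpoly ι_v(γ_H) = χ_g · (X − u)`), `IsLocalGRegular.separable_finCharpolyTwo`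
import Literature.NumberTheory.Rogawski1990.XiLocalCharacter                                  -- ★ `OneDimAutRepH.xiLocalChar`, `xiLocalChar_apply`, `localDet`
import Literature.NumberTheory.Automorphic.LocalEndoscopicOrbitClosed                         -- ★ `isGRegular_of_isStablyConjH`, `IsGRegular.isRegularElt_fst`
import HarnessLib

/-!
# F0 · P3c · line LH6 «StCharTS» — road «ST-STABLE-H★», brick (B2) «Ω∕XI-STABLE★» + the Ω-READING SEAM: the invariants of `γ_H ∈ H_v` that the
# rung-0 stability antecedent `hstab` reads are STABLE CLASS FUNCTIONS, and «`ι_v(γ_H) ∈ Ω`» is read on the `U(Φ₂)`-component [Rogawski1990 §4.3 p. 42; §12.5 p. 182; §3.1]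

Cell `pub/hodgecm-mathlib`, crux H413 = `stmt-HodgeConjecture-24833` (`--supports` lane, helper), route HCCMUnconditional; seat F0P3a-p05 (g22); road «ST-STABLE-H★»
(holder F0P3-p04 (g18), NAMING 2026-09-02T13:58:38Z, LEAD «=» T13-40; co-hands LH1-p03 (g8) on (B3) «HYP-CONJ₂★», this seat on (B2) + seam, split 14:05:42Z).
THEOREMS ONLY, sorry-free, no definition ∕ instance ∕ notation ∕ named fact; Mathlib + ★ tree modules.

THE SETTING.  `v` a finite place of `L⁺`, `E_v = ∏_{w ∣ v} L_w` (★ `UnitaryGroup.LocalRing L v`), `σ = c ⊗ 1` (★ `conjLocal`); `H_v = U(Φ₂)(L⁺_v) × U(Φ₁)(L⁺_v)` on the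
`cmDatum` carriers (the source of ★ `endoEmbLocal L v = ι_v`), `G_v = U(Φ₃)(L⁺_v) = Gqs L v`; for `γ_H = (g, u) ∈ H_v`: `χ_g = finCharpolyTwo L v γ_H`, `u = finGammaTwo L v γ_H`,
`charpoly ι_v(γ_H) = χ_g · (X − u)` (★ `charpoly_endoEmbLocal`).  Stable conjugacy in `H_v` (★ `IsLocalStablyConjH`) is conjugacy in `GL₂(E_v) × GL₁(E_v)`;
`G`-regularity (★ `IsLocalGRegular`) is separability of `charpoly ι_v(γ_H)`; `Ω = hyperbolicSet L v ⊆ G_v` is the regular hyperbolic set of the §12.5 datum (★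
`F0P3cStCharTSTorusDefs.hyperbolicSet`), characterised at a NON-SPLIT `v` by ★ HYP-EIG `mem_hyperbolicSet_iff`: «regular, with an eigenvalue `α ∈ E_v`, `α σ(α) ≠ 1`».

CONTENTS (what (B4) «`hstab_holds`» consumes by name).
* §1 (every finite `v`) STABLE CLASS FUNCTIONS: `isLocalGRegular_iff_of_isLocalStablyConjH` (★ `isGRegular_of_isStablyConjH` both ways); `localDet_fst_eq_of_isLocalStablyConjH`,
  `localDet_endoEmbLocal_eq_of_isLocalStablyConjH` (determinants of `GL`-conjugates); **`xiLocalChar_eq_of_isLocalStablyConjH`**: `ξ_v(γ_H) = ξ_v(γ_H′)` for `γ_H ∼_st γ_H′`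
  (`ξ_v = η_v ∘ det₀ · ψ_v ∘ det ∘ ι_v` reads determinants only, ★ `xiLocalChar_apply`).
* §2 (every finite `v`) THE `U(Φ₁)`-COORDINATE IS ON THE NORM-ONE TORUS: `conjLocal_finGammaTwo_mul_finGammaTwo'` (`σ(u) u = 1`, from membership in `U((1))`; a private twin of ★
  `conjLocal_finGammaTwo_mul_finGammaTwo`, whose home module is import-heavy), `finGammaTwo_mul_conjLocal_finGammaTwo`; the ROOT DICHOTOMY `isRoot_charpoly_endoEmbLocal_iff`:
  `α` is a root of `charpoly ι_v(γ_H)` iff `χ_g(α) = 0 ∨ α = u`.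
* §3 (NON-SPLIT `v`) THE Ω-READING SEAM: **`exists_isRoot_finCharpolyTwo_of_mem_hyperbolicSet`** — `ι_v(γ_H) ∈ Ω ⇒ χ_g` has a root `α` with `α σ(α) ≠ 1` (the `Ω`-eigenvalue of
  `χ_g · (X − u)` cannot be `u`, since `u σ(u) = 1`); **`endoEmbLocal_mem_hyperbolicSet_of_isRoot`** — conversely for `G`-regular `γ_H`; **`endoEmbLocal_mem_hyperbolicSet_iff`**
  (`ι_v(γ_H) ∈ Ω ↔ γ_H` is `G`-regular ∧ `∃ α, χ_g(α) = 0 ∧ α σ(α) ≠ 1`); `isRegularElt_fst_of_isLocalGRegular` (`g` is regular semisimple in `GL₂(E_v)`); and the (B2) head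
  **`endoEmbLocal_mem_hyperbolicSet_iff_of_isLocalStablyConjH`**: `ι_v(γ_H) ∈ Ω ↔ ι_v(γ_H′) ∈ Ω` for `γ_H ∼_st γ_H′`.
With LH1-p03 (g8)'s (B3) head `isConj_of_isLocalStablyConjH_of_isRoot (hns) (hst) (hreg : IsRegularElt ↑a.1) (hα) (hne) : IsConj a b`, §3 gives in two lines the road's
«on `{G-regular γ_H | ι_v(γ_H) ∈ Ω}` stable conjugacy IS `H_v`-conjugacy» [Rogawski1990 §12.5 p. 182: the classes meeting the split torus].
HONEST LABEL: HC_CM is proved only modulo the 7 printed citations (2 remaining: hLiu418 = `stmt-HodgeConjecture-24832`, h413 = `stmt-HodgeConjecture-24833`) until rung 0 closes;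
this file is count-neutral class bookkeeping and closes no organ.

## References
* [Rogawski1990] J. D. Rogawski, *Automorphic Representations of Unitary Groups in Three Variables*, Ann. of Math. Stud. 123 (1990): §3.1 p. 19 (stable conjugacy), §4.3
  p. 42 (`G`-regular elements of `H`), §4.8 Case (a) p. 53 (`H = U(2) × U(1) ⊂ U(3)`), §12.5 p. 182 (the regular hyperbolic set, elliptic elements), §13.3 p. 202 (`ξ(h) = η(det₀ h) ψ(det h)`).
-/

set_option autoImplicit false
-- the mandated namespace has the single-problem summit's repeated segment (`HodgeConjecture.HodgeConjecture`)
set_option linter.dupNamespace false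

noncomputable section

open NumberField IsDedekindDomain Matrix Polynomial
open scoped MatrixGroups
open Literature.NumberTheory.Rogawski1990 Literature.NumberTheory.Automorphic Literature.NumberTheory.Automorphic.UnitaryGroup
open Summit.HodgeConjecture.HodgeConjecture.Cruxes.H413.F0P3cStCharTSTorusDefs
open Summit.HodgeConjecture.HodgeConjecture.Cruxes.H413.F0P3cStCharTSHyperbolicSet
open Summit.HodgeConjecture.HodgeConjecture.Cruxes.H413.F0P3cStCharTSHyperbolicSetEigen

namespace Summit.HodgeConjecture.HodgeConjecture.Cruxes.H413.F0P3cStCharTSStableInvariantsH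

variable (L : Type) [Field L] [NumberField L] [IsCMField L] (v : HeightOneSpectrum (𝓞 ↥(maximalRealSubfield L)))
  {a b : (UnitaryGroup.cmDatum L 2 (Matrix.of fun i j : Fin 2 => if i.val + j.val + 1 = 2 then (1 : L) else 0)).Local v ×
      (UnitaryGroup.cmDatum L 1 (Matrix.of fun i j : Fin 1 => if i.val + j.val + 1 = 1 then (1 : L) else 0)).Local v}

/-! ## §1 Stable class functions on `H_v` (every finite place): `G`-regularity, the two determinants, `ξ_v` -/

/-- **`G`-regularity is a stable class function on `H_v`**: `γ_H ∼_st γ_H′ ⇒ (γ_H` is `G`-regular `↔ γ_H′` is`)` (★ `isGRegular_of_isStablyConjH`, both ways; `charpoly ι_v(·)` is a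
stable invariant). [cite: Rogawski1990, §4.3 p. 42; §3.1 p. 19] -/
theorem isLocalGRegular_iff_of_isLocalStablyConjH (h : IsLocalStablyConjH L v a b) : IsLocalGRegular L v a ↔ IsLocalGRegular L v b :=
  ⟨isGRegular_of_isStablyConjH _ _ _ _ h, isGRegular_of_isStablyConjH _ _ _ _ h.symm⟩

/-- A `G`-regular `γ_H = (g, u)` has `g` regular semisimple in `GL₂(E_v)` (`χ_g · (X − u)` separable ⇒ `χ_g` separable; ★ `IsGRegular.isRegularElt_fst`).
[cite: Rogawski1990, §4.3 p. 42] -/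
theorem isRegularElt_fst_of_isLocalGRegular (ha : IsLocalGRegular L v a) : IsRegularElt (a.1.val : GL (Fin 2) (LocalRing L v)) :=
  IsGRegular.isRegularElt_fst _ _ _ _ ha

/-- **`det₀ = det g` is a stable class function on `H_v`** (in `E¹_v`): conjugate elements of `GL₂(E_v)` have the same determinant. [cite: Rogawski1990, §3.13; §3.1 p. 19] -/
theorem localDet_fst_eq_of_isLocalStablyConjH (h : IsLocalStablyConjH L v a b) :
    localDet (IsCMField.complexConj L) v (isUnit_antidiagOne_det L 2) a.1 = localDet (IsCMField.complexConj L) v (isUnit_antidiagOne_det L 2) b.1 := by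
  obtain ⟨c, hc⟩ := isConj_iff.1 h.1
  refine Subtype.ext (Units.ext ?_)
  simp only [coe_coe_localDet]
  rw [← hc, Units.val_mul, Units.val_mul, Matrix.det_units_conj]

/-- **`det ∘ ι_v` is a stable class function on `H_v`** (in `E¹_v`): `ι_v(γ_H) ∼_st ι_v(γ_H′)` in `U(Φ₃)(L⁺_v)` (★ `isStablyConj_endoEmbLocal_of_isLocalStablyConjH`), and conjugate
elements of `GL₃(E_v)` have the same determinant. [cite: Rogawski1990, §4.8 Case (a) p. 53; §3.1 p. 19] -/
theorem localDet_endoEmbLocal_eq_of_isLocalStablyConjH (h : IsLocalStablyConjH L v a b) :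
    localDet (IsCMField.complexConj L) v (isUnit_antidiagOne_det L 3) (endoEmbLocal L v a) =
      localDet (IsCMField.complexConj L) v (isUnit_antidiagOne_det L 3) (endoEmbLocal L v b) := by
  obtain ⟨c, hc⟩ := isConj_iff.1 (isStablyConj_endoEmbLocal_of_isLocalStablyConjH L v h)
  refine Subtype.ext (Units.ext ?_)
  simp only [coe_coe_localDet]
  rw [← hc, Units.val_mul, Units.val_mul, Matrix.det_units_conj]

/-- **`ξ_v` IS A STABLE CLASS FUNCTION ON `H_v`**: for a one-dimensional `ξ = (η, ψ)` and `γ_H ∼_st γ_H′`, `ξ_v(γ_H) = ξ_v(γ_H′)` — `ξ_v(h₀, u) = η_v(det h₀) · ψ_v(det ι_v(h₀, u))`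
(★ `xiLocalChar_apply`) reads the two determinants only. [cite: Rogawski1990, §13.3 p. 202; §3.1 p. 19] -/
theorem xiLocalChar_eq_of_isLocalStablyConjH (ξ : OneDimAutRepH L) (h : IsLocalStablyConjH L v a b) : ξ.xiLocalChar v a = ξ.xiLocalChar v b := by
  rw [OneDimAutRepH.xiLocalChar_apply, OneDimAutRepH.xiLocalChar_apply, localDet_fst_eq_of_isLocalStablyConjH L v h,
    localDet_endoEmbLocal_eq_of_isLocalStablyConjH L v h]

/-- `χ_g` and `u` are stable class functions (★ p839998, re-exported in the orientation `a ↦ b` used below). [cite: Rogawski1990, §4.9 p. 55; §3.1 p. 19] -/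
theorem finCharpolyTwo_eq_and_finGammaTwo_eq_of_isLocalStablyConjH (h : IsLocalStablyConjH L v a b) :
    finCharpolyTwo L v a = finCharpolyTwo L v b ∧ finGammaTwo L v a = finGammaTwo L v b :=
  ⟨(finCharpolyTwo_eq_of_isLocalStablyConjH L v h).symm, (finGammaTwo_eq_of_isLocalStablyConjH L v h).symm⟩

/-! ## §2 The `U(Φ₁)`-coordinate lies on the norm-one torus; the root dichotomy of `charpoly ι_v(γ_H) = χ_g · (X − u)` (every finite place) -/

omit [IsCMField L] in
/-- The local form of `Φ₁ = (1)` is `(1)`: its `(0,0)` entry is `1`. [cite: Rogawski1990, §4.8 Case (a) p. 53] -/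
private theorem localFormOne_apply :
    adeleToLocal L v (adelicForm L 1 (Matrix.of fun i j : Fin 1 => if i.val + j.val + 1 = 1 then (1 : L) else 0) 0 0) = 1 := by
  rw [adelicForm, Matrix.map_apply, Matrix.of_apply]
  simp

/-- **`σ(u) · u = 1`** for the `U(Φ₁)`-coordinate `u = finGammaTwo L v γ_H` (membership of `γ_H.2` in the `1 × 1` unitary group of the form `(1)`); a light-import twin of ★
`conjLocal_finGammaTwo_mul_finGammaTwo`. [cite: Rogawski1990, §4.8 Case (a) p. 53; §4.9 p. 55] -/
theorem conjLocal_finGammaTwo_mul_finGammaTwo' : conjLocal L (IsCMField.complexConj L) v (finGammaTwo L v a) * finGammaTwo L v a = 1 := by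
  have hmem : ((a.2.val.val : Matrix (Fin 1) (Fin 1) (LocalRing L v)).map (conjLocal L (IsCMField.complexConj L) v))ᵀ *
      (adelicForm L 1 (Matrix.of fun i j : Fin 1 => if i.val + j.val + 1 = 1 then (1 : L) else 0)).map (adeleToLocal L v) *
      (a.2.val.val : Matrix (Fin 1) (Fin 1) (LocalRing L v)) =
      (adelicForm L 1 (Matrix.of fun i j : Fin 1 => if i.val + j.val + 1 = 1 then (1 : L) else 0)).map (adeleToLocal L v) :=
    mem_unitaryGroupOfForm_iff.mp a.2.2
  have h00 := congrFun (congrFun hmem 0) 0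
  simp only [Matrix.mul_apply, Fin.sum_univ_one, Matrix.transpose_apply, Matrix.map_apply, localFormOne_apply, mul_one] at h00
  exact h00

/-- `u · σ(u) = 1` (commuted form). [cite: Rogawski1990, §4.9 p. 55] -/
theorem finGammaTwo_mul_conjLocal_finGammaTwo : finGammaTwo L v a * conjLocal L (IsCMField.complexConj L) v (finGammaTwo L v a) = 1 := by
  rw [mul_comm]; exact conjLocal_finGammaTwo_mul_finGammaTwo' L v

/-- **`charpoly ι_v(γ_H) (α) = χ_g(α) · (α − u)`** (evaluation of ★ `charpoly_endoEmbLocal`; every place — at a split place `E_v` has zero divisors, so the root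
DICHOTOMY «root of `χ_g` or `= u`» is stated below only at a non-split place, while the two one-sided consequences hold everywhere). [cite: Rogawski1990, §4.3 p. 42; §4.9 p. 55] -/
theorem eval_charpoly_endoEmbLocal (α : LocalRing L v) :
    (((endoEmbLocal L v a).val : GL (Fin 3) (LocalRing L v)) : Matrix (Fin 3) (Fin 3) (LocalRing L v)).charpoly.eval α =
      (finCharpolyTwo L v a).eval α * (α - finGammaTwo L v a) := by
  rw [charpoly_endoEmbLocal, eval_mul, eval_sub, eval_X, eval_C]

/-- A root of `χ_g` is a root of `charpoly ι_v(γ_H)`. [cite: Rogawski1990, §4.3 p. 42] -/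
theorem isRoot_charpoly_endoEmbLocal_of_isRoot_finCharpolyTwo {α : LocalRing L v} (hα : (finCharpolyTwo L v a).IsRoot α) :
    (((endoEmbLocal L v a).val : GL (Fin 3) (LocalRing L v)) : Matrix (Fin 3) (Fin 3) (LocalRing L v)).charpoly.IsRoot α := by
  rw [IsRoot, eval_charpoly_endoEmbLocal, hα.eq_zero, zero_mul]

/-- `u` is a root of `charpoly ι_v(γ_H)`. [cite: Rogawski1990, §4.9 p. 55] -/
theorem isRoot_charpoly_endoEmbLocal_finGammaTwo :
    (((endoEmbLocal L v a).val : GL (Fin 3) (LocalRing L v)) : Matrix (Fin 3) (Fin 3) (LocalRing L v)).charpoly.IsRoot (finGammaTwo L v a) := by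
  rw [IsRoot, eval_charpoly_endoEmbLocal, sub_self, mul_zero]

/-- **At a NON-SPLIT place** (`E_v = L_w` a field up to `IsField`): a root of `charpoly ι_v(γ_H)` is a root of `χ_g` or equals `u`. [cite: Rogawski1990, §4.3 p. 42; §4.9 p. 55] -/
theorem isRoot_finCharpolyTwo_or_eq_finGammaTwo_of_isRoot (hns : ∀ w : PlacesOver L v, IsCMField.complexConj L • w.1 = w.1) {α : LocalRing L v}
    (hα : (((endoEmbLocal L v a).val : GL (Fin 3) (LocalRing L v)) : Matrix (Fin 3) (Fin 3) (LocalRing L v)).charpoly.IsRoot α) :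
    (finCharpolyTwo L v a).IsRoot α ∨ α = finGammaTwo L v a := by
  rw [IsRoot, eval_charpoly_endoEmbLocal] at hα
  by_cases h1 : (finCharpolyTwo L v a).eval α = 0
  · exact Or.inl h1
  by_cases h2 : α = finGammaTwo L v a
  · exact Or.inr h2
  obtain ⟨u₁, hu₁⟩ := F0P3cStCharTSWeylHypCM.isUnit_of_ne_zero_of_nonsplit L v hns _ h1
  obtain ⟨u₂, hu₂⟩ := F0P3cStCharTSWeylHypCM.isUnit_of_ne_zero_of_nonsplit L v hns _ (sub_ne_zero.2 h2)
  rw [← hu₁, ← hu₂, ← Units.val_mul] at hα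
  exact absurd hα (u₁ * u₂).ne_zero

/-! ## §3 The Ω-reading seam (non-split `v`): «`ι_v(γ_H) ∈ Ω`» is read on `χ_g`, and is a stable class function -/

set_option maxHeartbeats 1600000 in  -- statement-level `whnf` on the CM carriers (`Gqs`, `LocalRing`), as in ★ HYP-EIG
/-- **`ι_v(γ_H) ∈ Ω ⇒ χ_g` HAS A ROOT `α` WITH `α σ(α) ≠ 1`** (non-split `v`): ★ HYP-EIG `exists_isRoot_of_mem_hyperbolicSet` gives a root `α` of `charpoly ι_v(γ_H) = χ_g · (X − u)` with
`α σ(α) ≠ 1`; it is not `u` because `u σ(u) = 1` (§2), so it is a root of `χ_g`. [cite: Rogawski1990, §12.5 p. 182; §4.3 p. 42] -/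
theorem exists_isRoot_finCharpolyTwo_of_mem_hyperbolicSet (hns : ∀ w : PlacesOver L v, IsCMField.complexConj L • w.1 = w.1)
    (hΩ : endoEmbLocal L v a ∈ hyperbolicSet L v) :
    ∃ α : LocalRing L v, (finCharpolyTwo L v a).IsRoot α ∧ α * conjLocal L (IsCMField.complexConj L) v α ≠ 1 := by
  obtain ⟨α, hα, hne⟩ := exists_isRoot_of_mem_hyperbolicSet L v hΩ
  refine ⟨α, ?_, hne⟩
  rcases isRoot_finCharpolyTwo_or_eq_finGammaTwo_of_isRoot L v hns hα with h | h
  · exact h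
  · exact absurd (h ▸ finGammaTwo_mul_conjLocal_finGammaTwo L v) hne

set_option maxHeartbeats 1600000 in  -- statement-level `whnf` on the CM carriers
/-- The same, read on the matrix of the `U(Φ₂)`-component (the token shape of (B3)'s hypotheses `hα`, `hne`). [cite: Rogawski1990, §12.5 p. 182; §4.3 p. 42] -/
theorem exists_isRoot_charpoly_fst_of_mem_hyperbolicSet (hns : ∀ w : PlacesOver L v, IsCMField.complexConj L • w.1 = w.1)
    (hΩ : endoEmbLocal L v a ∈ hyperbolicSet L v) :
    ∃ α : LocalRing L v, ((a.1.val : GL (Fin 2) (LocalRing L v)) : Matrix (Fin 2) (Fin 2) (LocalRing L v)).charpoly.IsRoot α ∧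
      α * conjLocal L (IsCMField.complexConj L) v α ≠ 1 :=
  exists_isRoot_finCharpolyTwo_of_mem_hyperbolicSet L v hns hΩ

set_option maxHeartbeats 1600000 in  -- statement-level `whnf` on the CM carriers
/-- `ι_v(γ_H) ∈ Ω ⇒ γ_H` is `G`-regular (★ `isRegularElt_of_mem_hyperbolicSet`; every place). [cite: Rogawski1990, §12.5 p. 182; §4.3 p. 42] -/
theorem isLocalGRegular_of_mem_hyperbolicSet (hΩ : endoEmbLocal L v a ∈ hyperbolicSet L v) : IsLocalGRegular L v a :=
  isRegularElt_of_mem_hyperbolicSet L v hΩ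

set_option maxHeartbeats 1600000 in  -- statement-level `whnf` on the CM carriers
/-- **CONVERSELY: `G`-regular `γ_H` with a root `α` of `χ_g`, `α σ(α) ≠ 1`, has `ι_v(γ_H) ∈ Ω`** (non-split `v`; ★ HYP-EIG `mem_hyperbolicSet_of_isRoot` at the root `α` of
`charpoly ι_v(γ_H) = χ_g · (X − u)`). [cite: Rogawski1990, §12.5 p. 182; §4.3 p. 42] -/
theorem endoEmbLocal_mem_hyperbolicSet_of_isRoot (hns : ∀ w : PlacesOver L v, IsCMField.complexConj L • w.1 = w.1) (ha : IsLocalGRegular L v a)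
    {α : LocalRing L v} (hα : (finCharpolyTwo L v a).IsRoot α) (hne : α * conjLocal L (IsCMField.complexConj L) v α ≠ 1) :
    endoEmbLocal L v a ∈ hyperbolicSet L v :=
  mem_hyperbolicSet_of_isRoot L v hns ha (isRoot_charpoly_endoEmbLocal_of_isRoot_finCharpolyTwo L v hα) hne

set_option maxHeartbeats 1600000 in  -- statement-level `whnf` on the CM carriers
/-- **THE Ω-READING ON `H_v`** (non-split `v`): `ι_v(γ_H) ∈ Ω ↔ γ_H` is `G`-regular and `χ_g` has a root `α ∈ E_v` with `α σ(α) ≠ 1`.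
[cite: Rogawski1990, §12.5 p. 182; §4.3 p. 42] -/
theorem endoEmbLocal_mem_hyperbolicSet_iff (hns : ∀ w : PlacesOver L v, IsCMField.complexConj L • w.1 = w.1) :
    endoEmbLocal L v a ∈ hyperbolicSet L v ↔
      IsLocalGRegular L v a ∧ ∃ α : LocalRing L v, (finCharpolyTwo L v a).IsRoot α ∧ α * conjLocal L (IsCMField.complexConj L) v α ≠ 1 :=
  ⟨fun hΩ => ⟨isLocalGRegular_of_mem_hyperbolicSet L v hΩ, exists_isRoot_finCharpolyTwo_of_mem_hyperbolicSet L v hns hΩ⟩,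
    fun ⟨ha, _, hα, hne⟩ => endoEmbLocal_mem_hyperbolicSet_of_isRoot L v hns ha hα hne⟩

set_option maxHeartbeats 1600000 in  -- statement-level `whnf` on the CM carriers
/-- **(B2) «Ω-STABLE★»: `ι_v(γ_H) ∈ Ω` IS A STABLE CLASS FUNCTION OF `γ_H`** (non-split `v`): both sides of the Ω-reading are — `G`-regularity (§1) and `χ_g` (★ p839998).
[cite: Rogawski1990, §12.5 p. 182; §3.1 p. 19] -/
theorem endoEmbLocal_mem_hyperbolicSet_iff_of_isLocalStablyConjH (hns : ∀ w : PlacesOver L v, IsCMField.complexConj L • w.1 = w.1)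
    (h : IsLocalStablyConjH L v a b) : endoEmbLocal L v a ∈ hyperbolicSet L v ↔ endoEmbLocal L v b ∈ hyperbolicSet L v := by
  rw [endoEmbLocal_mem_hyperbolicSet_iff L v hns, endoEmbLocal_mem_hyperbolicSet_iff L v hns, isLocalGRegular_iff_of_isLocalStablyConjH L v h,
    (finCharpolyTwo_eq_and_finGammaTwo_eq_of_isLocalStablyConjH L v h).1]

set_option maxHeartbeats 1600000 in  -- statement-level `whnf` on the CM carriers
/-- **THE ROAD'S SET `V_H = {γ_H | G-regular ∧ ι_v(γ_H) ∉ Ω}` IS STABLE**: `γ_H ∼_st γ_H′ ⇒ (γ_H ∈ V_H ↔ γ_H′ ∈ V_H)` (non-split `v`). [cite: Rogawski1990, §12.5 p. 182; §3.1 p. 19] -/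
theorem mem_setOf_isLocalGRegular_and_not_mem_hyperbolicSet_iff_of_isLocalStablyConjH
    (hns : ∀ w : PlacesOver L v, IsCMField.complexConj L • w.1 = w.1) (h : IsLocalStablyConjH L v a b) :
    a ∈ {x | IsLocalGRegular L v x ∧ endoEmbLocal L v x ∉ hyperbolicSet L v} ↔
      b ∈ {x | IsLocalGRegular L v x ∧ endoEmbLocal L v x ∉ hyperbolicSet L v} := by
  simp only [Set.mem_setOf_eq]
  rw [isLocalGRegular_iff_of_isLocalStablyConjH L v h, endoEmbLocal_mem_hyperbolicSet_iff_of_isLocalStablyConjH L v hns h]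

end Summit.HodgeConjecture.HodgeConjecture.Cruxes.H413.F0P3cStCharTSStableInvariantsH
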